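import Mathlib
import Literature.Probability.Percolation.SmoothedWhiteNoise
import Literature.Probability.Percolation.Crossings

/-!
# Medial cells of `δℤ²` and smooth cell bumps

Helper file for item `NoiseDiscretisation` (stmt-CriticalPhenomena-4598) of route
`CardyWhiteToColoured` (`CardyFormulaZ2`). The coupling of the lattice white noise (i.i.d.
`N(0,1)` variables on the edges of `ℤ²`, i.e. on the medial lattice) with the continuum white noise
`ω` sets `ξ_e := ω(g_e)` for an `L²`-orthonormal family of smooth bumps `g_e` supported in the
pairwise disjoint *medial cells*. The medial points `m_δ(e)` of `δℤ²` form the square lattice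
`(δ/2)·{(a, b) ∈ ℤ² : a + b odd}`, whose Voronoi cells are the diamonds
`{z : |Re(z − m)| + |Im(z − m)| < δ/2}`; in the rotated coordinates `p = Re + Im`, `q = Re − Im`
these are squares, and `|Re w| + |Im w| = max(|p(w)|, |q(w)|) =: Dg[w]`.

Contents (no definitions; the recurring objects are local notations):
* `Dg[w]`: triangle inequality, symmetry, `‖w‖ ≤ Dg[w] ≤ 2‖w‖`;
* `le_dg_medialPoint_sub`: distinct edges have medial points at `Dg`-distance `≥ δ` (parity);
* `exists_bump`: a smooth `β : ℝ → ℝ`, `= 1` on `[−r₁, r₁]`, supported in `(−r₂, r₂)`, valued in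
  `[0, 1]` (Mathlib's `ContDiffBump`); the cell bump `hB[β, m, z] = β(p(z − m)) β(q(z − m))` is
  smooth, compactly supported in `{Dg[· − m] < r₂}`, `= 1` on `{Dg[· − m] ≤ r₁}`, valued in
  `[0, 1]`, and bumps of distinct cells have disjoint supports when `2 r₂ ≤ δ`;
* integrals: `∫ hB[β, m, ·]² = ∫ hB[β, 0, ·]² > 0`, and `∫ hB[β, m, ·] hB[β, m', ·] = 0` for distinct cells.

References: S. Muirhead, H. Vanneuville, Ann. Inst. H. Poincaré Probab. Stat. 56 (2020), §2.1
(discretised white noise); S. Smirnov, C. R. Acad. Sci. Paris 333 (2001), §2 (medial lattice).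
-/

noncomputable section

namespace Summit.CriticalPhenomena.CardyFormulaZ2.Theorems

namespace WhiteToColoured

open Set Metric MeasureTheory Filter Topology
open scoped ContDiff
open Literature.Probability.LatticeModels Literature.Probability.Percolation

/-- `Dg[w] = max |Re w + Im w| |Re w − Im w| = |Re w| + |Im w|`, the rotated sup-distance. -/
local notation3 "Dg[" w "]" => max |Complex.re w + Complex.im w| |Complex.re w - Complex.im w|

/-- The value `hB[β, m, z] = β (p (z − m)) · β (q (z − m))` of the cell bump built from a
one-dimensional bump `β` and centred at `m`. -/
local notation3 "hB[" β ", " m ", " z "]" =>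
  (β : ℝ → ℝ) (Complex.re (z - m) + Complex.im (z - m)) * β (Complex.re (z - m) - Complex.im (z - m))

/-! ### The rotated sup-distance -/

/-- `Dg` is non-negative. -/
theorem dg_nonneg (w : ℂ) : 0 ≤ Dg[w] := le_max_of_le_left (abs_nonneg _)

/-- `Dg` is symmetric under negation. -/
theorem dg_neg (w : ℂ) : Dg[-w] = Dg[w] := by
  simp only [Complex.neg_re, Complex.neg_im]
  rw [show -w.re + -w.im = -(w.re + w.im) by ring, show -w.re - -w.im = -(w.re - w.im) by ring,
    abs_neg, abs_neg]

/-- `Dg` of a difference is symmetric. -/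
theorem dg_sub_comm (w w' : ℂ) : Dg[w - w'] = Dg[w' - w] := by
  rw [← dg_neg, neg_sub]

/-- Triangle inequality for `Dg`. -/
theorem dg_add_le (w w' : ℂ) : Dg[w + w'] ≤ Dg[w] + Dg[w'] := by
  simp only [Complex.add_re, Complex.add_im]
  refine max_le ?_ ?_
  · calc |w.re + w'.re + (w.im + w'.im)| = |(w.re + w.im) + (w'.re + w'.im)| := by ring_nf
      _ ≤ |w.re + w.im| + |w'.re + w'.im| := abs_add_le _ _
      _ ≤ Dg[w] + Dg[w'] := add_le_add (le_max_left _ _) (le_max_left _ _)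
  · calc |w.re + w'.re - (w.im + w'.im)| = |(w.re - w.im) + (w'.re - w'.im)| := by ring_nf
      _ ≤ |w.re - w.im| + |w'.re - w'.im| := abs_add_le _ _
      _ ≤ Dg[w] + Dg[w'] := add_le_add (le_max_right _ _) (le_max_right _ _)

/-- Triangle inequality for `Dg` of differences. -/
theorem dg_sub_le (a b c : ℂ) : Dg[a - c] ≤ Dg[a - b] + Dg[b - c] := by
  have := dg_add_le (a - b) (b - c)
  rwa [sub_add_sub_cancel] at this

/-- The Euclidean norm is at most the rotated sup-distance `Dg`. -/
theorem norm_le_dg (w : ℂ) : ‖w‖ ≤ Dg[w] := by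
  have h0 : 0 ≤ Dg[w] := dg_nonneg w
  rw [← abs_of_nonneg (norm_nonneg w), ← abs_of_nonneg h0, ← sq_le_sq, Complex.sq_norm,
    Complex.normSq_apply]
  rcases le_total |w.re + w.im| |w.re - w.im| with h | h
  · rw [max_eq_right h, sq_abs]
    nlinarith [sq_nonneg (w.re + w.im), sq_abs (w.re + w.im), sq_abs (w.re - w.im),
      abs_nonneg (w.re + w.im), abs_nonneg (w.re - w.im)]
  · rw [max_eq_left h, sq_abs]
    nlinarith [sq_nonneg (w.re - w.im), sq_abs (w.re + w.im), sq_abs (w.re - w.im),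
      abs_nonneg (w.re + w.im), abs_nonneg (w.re - w.im)]

/-- The rotated sup-distance `Dg` is at most twice the Euclidean norm. -/
theorem dg_le_two_mul_norm (w : ℂ) : Dg[w] ≤ 2 * ‖w‖ := by
  have h1 := Complex.abs_re_le_norm w
  have h2 := Complex.abs_im_le_norm w
  refine max_le ?_ ?_
  · calc |w.re + w.im| ≤ |w.re| + |w.im| := abs_add_le _ _
      _ ≤ 2 * ‖w‖ := by linarith
  · calc |w.re - w.im| ≤ |w.re| + |w.im| := abs_sub _ _
      _ ≤ 2 * ‖w‖ := by linarith

/-! ### Medial points of distinct edges are `Dg`-separated -/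

/-- Real and imaginary parts of a medial point. -/
theorem medialPoint_re_im (δ : ℝ) (x y : Site 2) :
    (medialPoint δ s(x, y)).re = δ * ((x 0 : ℝ) + y 0) / 2 ∧
      (medialPoint δ s(x, y)).im = δ * ((x 1 : ℝ) + y 1) / 2 := by
  rw [medialPoint_mk]
  constructor
  · simp only [Complex.div_ofNat_re, Complex.add_re, meshPoint_re]; ring
  · simp only [Complex.div_ofNat_im, Complex.add_im, meshPoint_im]; ring

/-- **Separation of the medial lattice**: distinct edges of `ℤ²` have medial points at rotated
sup-distance at least `δ` (the coordinate sums of `2 m_δ(e)/δ` are odd, so differences of distinct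
medial points have both rotated coordinates even and not both zero). -/
theorem le_dg_medialPoint_sub {δ : ℝ} (hδ : 0 < δ) {e e' : Sym2 (Site 2)}
    (he : e ∈ (zdGraph 2).edgeSet) (he' : e' ∈ (zdGraph 2).edgeSet) (hne : e ≠ e') :
    δ ≤ Dg[medialPoint δ e - medialPoint δ e'] := by
  obtain ⟨u, i, rfl⟩ := mem_edgeSet_zdGraph_iff.1 he
  obtain ⟨u', i', rfl⟩ := mem_edgeSet_zdGraph_iff.1 he'
  set v : Site 2 := Pi.single i 1 with hv
  set v' : Site 2 := Pi.single i' 1 with hv'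
  obtain ⟨hre, him⟩ := medialPoint_re_im δ u (u + v)
  obtain ⟨hre', him'⟩ := medialPoint_re_im δ u' (u' + v')
  have hvv : v 0 + v 1 = 1 ∧ (v 0 = 0 ∨ v 0 = 1) ∧ (v 1 = 0 ∨ v 1 = 1) := by
    fin_cases i <;> simp [hv]
  have hvv' : v' 0 + v' 1 = 1 ∧ (v' 0 = 0 ∨ v' 0 = 1) ∧ (v' 1 = 0 ∨ v' 1 = 1) := by
    fin_cases i' <;> simp [hv']
  -- integer rotated coordinates
  set a : ℤ := (u 0 + (u + v) 0) - (u' 0 + (u' + v') 0) with ha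
  set b : ℤ := (u 1 + (u + v) 1) - (u' 1 + (u' + v') 1) with hb
  have ha' : a = 2 * (u 0 - u' 0) + (v 0 - v' 0) := by rw [ha, Pi.add_apply, Pi.add_apply]; ring
  have hb' : b = 2 * (u 1 - u' 1) + (v 1 - v' 1) := by rw [hb, Pi.add_apply, Pi.add_apply]; ring
  have hre2 : (medialPoint δ s(u, u + v) - medialPoint δ s(u', u' + v')).re = δ * (a : ℝ) / 2 := by
    rw [Complex.sub_re, hre, hre', ha]; push_cast; ring
  have him2 : (medialPoint δ s(u, u + v) - medialPoint δ s(u', u' + v')).im = δ * (b : ℝ) / 2 := by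
    rw [Complex.sub_im, him, him', hb]; push_cast; ring
  -- the parity argument
  have key : (2 : ℤ) ≤ |a + b| ∨ (2 : ℤ) ≤ |a - b| := by
    by_contra hcon
    push Not at hcon
    obtain ⟨h1, h2⟩ := hcon
    have h1' := abs_lt.1 h1
    have h2' := abs_lt.1 h2
    obtain ⟨hs, h0, h1⟩ := hvv
    obtain ⟨hs', h0', h1'⟩ := hvv'
    have hu0 : u 0 = u' 0 := by omega
    have hu1 : u 1 = u' 1 := by omega
    have hw0 : v 0 = v' 0 := by omega
    have hw1 : v 1 = v' 1 := by omega
    have huu : u = u' := by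
      funext j; fin_cases j
      · exact hu0
      · exact hu1
    have hww : v = v' := by
      funext j; fin_cases j
      · exact hw0
      · exact hw1
    exact hne (by rw [huu, hww])
  rw [hre2, him2]
  have e1 : δ * (a : ℝ) / 2 + δ * (b : ℝ) / 2 = δ / 2 * ((a + b : ℤ) : ℝ) := by push_cast; ring
  have e2 : δ * (a : ℝ) / 2 - δ * (b : ℝ) / 2 = δ / 2 * ((a - b : ℤ) : ℝ) := by push_cast; ring
  rw [e1, e2, abs_mul, abs_mul, abs_of_pos (by positivity : (0 : ℝ) < δ / 2)]
  rcases key with h | h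
  · refine le_max_of_le_left ?_
    have : (2 : ℝ) ≤ |((a + b : ℤ) : ℝ)| := by rw [← Int.cast_abs]; exact_mod_cast h
    nlinarith
  · refine le_max_of_le_right ?_
    have : (2 : ℝ) ≤ |((a - b : ℤ) : ℝ)| := by rw [← Int.cast_abs]; exact_mod_cast h
    nlinarith

/-! ### One-dimensional bumps and cell bumps -/

/-- **A smooth one-dimensional bump** (Mathlib `ContDiffBump`): `β = 1` on `[−r₁, r₁]`, `β = 0`
off `(−r₂, r₂)`, `0 ≤ β ≤ 1`. -/
theorem exists_bump {r₁ r₂ : ℝ} (h₁ : 0 < r₁) (h₁₂ : r₁ < r₂) :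
    ∃ β : ℝ → ℝ, ContDiff ℝ ∞ β ∧ (∀ w, |w| ≤ r₁ → β w = 1) ∧ (∀ w, β w ≠ 0 → |w| < r₂) ∧
      (∀ w, 0 ≤ β w) ∧ ∀ w, β w ≤ 1 := by
  let f : ContDiffBump (0 : ℝ) := ⟨r₁, r₂, h₁, h₁₂⟩
  refine ⟨f, f.contDiff, fun w hw => f.one_of_mem_closedBall (by simpa using hw), fun w hw => ?_,
    fun w => f.nonneg, fun w => f.le_one⟩
  have : w ∈ Function.support f := hw
  rw [f.support_eq] at this
  simpa using this

section CellBump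

variable {β : ℝ → ℝ} {r₁ r₂ : ℝ}

/-- The cell bump is smooth. -/
theorem hB_contDiff (hβ : ContDiff ℝ ∞ β) (m : ℂ) : ContDiff ℝ ∞ (fun z : ℂ => hB[β, m, z]) := by
  have hre : ContDiff ℝ ∞ fun z : ℂ => (z - m).re :=
    Complex.reCLM.contDiff.comp (contDiff_id.sub contDiff_const)
  have him : ContDiff ℝ ∞ fun z : ℂ => (z - m).im :=
    Complex.imCLM.contDiff.comp (contDiff_id.sub contDiff_const)
  exact (hβ.comp (hre.add him)).mul (hβ.comp (hre.sub him))

/-- The cell bump is continuous. -/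
theorem hB_continuous (hβ : ContDiff ℝ ∞ β) (m : ℂ) : Continuous (fun z : ℂ => hB[β, m, z]) :=
  (hB_contDiff hβ m).continuous

/-- The cell bump equals `1` on the closed cell of radius `r₁`. -/
theorem hB_eq_one (hβ1 : ∀ w, |w| ≤ r₁ → β w = 1) {m z : ℂ} (hz : Dg[z - m] ≤ r₁) :
    hB[β, m, z] = 1 := by
  rw [hβ1 _ ((le_max_left _ _).trans hz), hβ1 _ ((le_max_right _ _).trans hz), one_mul]

/-- Off the open cell of radius `r₂` the cell bump vanishes. -/
theorem dg_lt_of_hB_ne_zero (hβ0 : ∀ w, β w ≠ 0 → |w| < r₂) {m z : ℂ} (hz : hB[β, m, z] ≠ 0) :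
    Dg[z - m] < r₂ :=
  max_lt (hβ0 _ (left_ne_zero_of_mul hz)) (hβ0 _ (right_ne_zero_of_mul hz))

/-- The cell bump takes values in `[0, 1]`. -/
theorem hB_nonneg (hβp : ∀ w, 0 ≤ β w) (m z : ℂ) : 0 ≤ hB[β, m, z] :=
  mul_nonneg (hβp _) (hβp _)

/-- The cell bump takes values in `[0, 1]`. -/
theorem hB_le_one (hβp : ∀ w, 0 ≤ β w) (hβ1 : ∀ w, β w ≤ 1) (m z : ℂ) : hB[β, m, z] ≤ 1 :=
  mul_le_one₀ (hβ1 _) (hβp _) (hβ1 _)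

/-- The cell bump is supported in the ball of radius `r₂` about the centre. -/
theorem hB_support_subset (hβ0 : ∀ w, β w ≠ 0 → |w| < r₂) (m : ℂ) :
    Function.support (fun z : ℂ => hB[β, m, z]) ⊆ ball m r₂ := fun z hz => by
  rw [mem_ball, dist_eq_norm]
  exact (norm_le_dg _).trans_lt (dg_lt_of_hB_ne_zero hβ0 hz)

/-- The cell bump has compact support. -/
theorem hB_hasCompactSupport (hβ0 : ∀ w, β w ≠ 0 → |w| < r₂) (m : ℂ) :
    HasCompactSupport (fun z : ℂ => hB[β, m, z]) :=
  HasCompactSupport.of_support_subset_isCompact (isCompact_closedBall m r₂)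
    ((hB_support_subset hβ0 m).trans ball_subset_closedBall)

/-- The cell bump is integrable, and so is its square and its product with a bounded continuous
function. -/
theorem hB_integrable (hβ : ContDiff ℝ ∞ β) (hβ0 : ∀ w, β w ≠ 0 → |w| < r₂) (m : ℂ) :
    Integrable (fun z : ℂ => hB[β, m, z]) :=
  (hB_continuous hβ m).integrable_of_hasCompactSupport (hB_hasCompactSupport hβ0 m)

/-- Translation: `hB[β, m, z] = hB[β, 0, z − m]`. -/
theorem hB_apply_eq (m z : ℂ) : hB[β, m, z] = hB[β, 0, z - m] := by simp

/-- **Bumps of separated cells have disjoint supports.** -/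
theorem hB_mul_hB_eq_zero (hβ0 : ∀ w, β w ≠ 0 → |w| < r₂) {m m' : ℂ} (hsep : r₂ + r₂ ≤ Dg[m - m'])
    (z : ℂ) : hB[β, m, z] * hB[β, m', z] = 0 := by
  by_contra h
  have h1 := dg_lt_of_hB_ne_zero hβ0 (left_ne_zero_of_mul h)
  have h2 := dg_lt_of_hB_ne_zero hβ0 (right_ne_zero_of_mul h)
  have := dg_sub_le m z m'
  rw [dg_sub_comm m z] at this
  linarith

/-- **The squared `L²` norm of a cell bump is translation invariant.** -/
theorem integral_hB_sq (m : ℂ) : ∫ z, hB[β, m, z] ^ 2 = ∫ z, hB[β, 0, z] ^ 2 := by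
  have : (fun z : ℂ => hB[β, m, z] ^ 2) = fun z => (fun w : ℂ => hB[β, 0, w] ^ 2) (z - m) := by
    funext z; simp
  rw [this, integral_sub_right_eq_self (μ := volume) (fun w : ℂ => hB[β, 0, w] ^ 2) m]

/-- **The squared `L²` norm of a cell bump is positive.** -/
theorem integral_hB_sq_pos (hβ : ContDiff ℝ ∞ β) (hβ1 : ∀ w, |w| ≤ r₁ → β w = 1)
    (hβ0 : ∀ w, β w ≠ 0 → |w| < r₂) (hr₁ : 0 < r₁) :
    0 < ∫ z, hB[β, 0, z] ^ 2 := by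
  have hint : Integrable fun z : ℂ => hB[β, 0, z] ^ 2 := by
    have h := ((hB_continuous hβ 0).mul (hB_continuous hβ 0)).integrable_of_hasCompactSupport
      (μ := volume) (hB_hasCompactSupport hβ0 0).mul_right
    refine h.congr (Filter.Eventually.of_forall fun z => ?_)
    simp only [Pi.mul_apply, sq]
  -- the bump is `1` on the ball of radius `r₁ / 2`
  have hone : ∀ z ∈ ball (0 : ℂ) (r₁ / 2), hB[β, 0, z] ^ 2 = 1 := by
    intro z hz
    rw [hB_eq_one hβ1, one_pow]
    rw [sub_zero]
    rw [mem_ball_zero_iff] at hz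
    linarith [dg_le_two_mul_norm z]
  have hle : (ball (0 : ℂ) (r₁ / 2)).indicator (fun _ => (1 : ℝ)) ≤ fun z => hB[β, 0, z] ^ 2 := by
    intro z
    by_cases hz : z ∈ ball (0 : ℂ) (r₁ / 2)
    · rw [indicator_of_mem hz]; exact (hone z hz).symm.le
    · rw [indicator_of_notMem hz]; exact sq_nonneg _
  calc (0 : ℝ) < ∫ z, (ball (0 : ℂ) (r₁ / 2)).indicator (fun _ => (1 : ℝ)) z := by
        rw [integral_indicator measurableSet_ball, setIntegral_const, smul_eq_mul, mul_one,
          Measure.real, ENNReal.toReal_pos_iff]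
        exact ⟨measure_ball_pos _ _ (by positivity), measure_ball_lt_top⟩
    _ ≤ ∫ z, hB[β, 0, z] ^ 2 :=
        integral_mono ((integrable_indicator_iff measurableSet_ball).2
          (integrableOn_const measure_ball_lt_top.ne)) hint hle

/-- **Bumps of separated cells are `L²`-orthogonal.** -/
theorem integral_hB_mul_hB (hβ0 : ∀ w, β w ≠ 0 → |w| < r₂) {m m' : ℂ}
    (hsep : r₂ + r₂ ≤ Dg[m - m']) : ∫ z, hB[β, m, z] * hB[β, m', z] = 0 := by
  simp only [hB_mul_hB_eq_zero hβ0 hsep, integral_zero]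

end CellBump

end WhiteToColoured

end Summit.CriticalPhenomena.CardyFormulaZ2.Theorems
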